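import Summits.ResolutionOfSingularities.ResolutionOfSingularities.Theorems.EquisingularLiftEquisingularLiftNatHyperplaneLetterSupport
import Summits.ResolutionOfSingularities.ResolutionOfSingularities.Theorems.EquisingularLiftEquisingularLiftNatSubchainSupplierInvSLDefs
import HarnessLib

/-!
# [OURS · L1 W4.5(b) · EL♮(3) · T23-A⁗ (F4)] HYPERPLANE LETTERS OVER `O`, part 3 — ★ `TCPlus.letterDatum_hyperplane`: the `LetterDatum` of a
# hyperplane `V₊(ℓ̃) ⊂ ℙ_O` at the INITIAL stage (`X = P`, `σ = 𝟙`, `jG = g = Proj φ`), with trace the `k`-hyperplane `{y | ℓ ∈ 𝔭_y}`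

res-type-027 g19 (FREE NAMED-RESERVE prover of chain w45b; res-L1-w45b-stub-4's `T23A4-ENGINE-WORD-v2.md` FINAL 81913c484db62a21 §1 («a hyperplane
`V₊(ℓ) ∋ x` has the CANONICAL model `V₊(ℓ̃) ⊂ ℙⁿ_O` … ⇒ `TCPlus.LetterDatum P 𝟙 j V₊(ℓ)` is CONSTRUCTIBLE from downstairs data») and §3 (L1)/(L3);
my feasibility word `L/res-type-027/g19/F4-FEASIBILITY.md` 8a547123c3effec5, deliverable (H2)). Crux `EquisingularLiftNatThree` =
stmt-ResolutionOfSingularities-20148 (parent stmt-…-20038), route `EquisingularLift`, line `sections`. OURS; NOT a statement of any manuscript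
([Hironaka2017] is a candidate under adjudication, nothing of it is asserted); AI-written, weaker than expert review. No `sorry`, no definition,
no instance; standard axioms. `--supports stmt-ResolutionOfSingularities-20148 --as helper`.

WHAT. For the EL♮ ambient `P = Proj O[x₀..x_{r+1}] → Spec O` (`O` a DVR, `π : O ↠ k`, `φ = map π` graded, `g = Proj φ : ℙ_k → ℙ_O` the special fibre,
`Y = (ι ≫ g)(H)` for an integral closed `ι : H ↪ ℙ_k`) and a coefficient vector `c : Fin (r+2) → O` with a UNIT coordinate `c a` — the linear form
`ℓ̃ = Σ_i C (c i) · X i` and its reduction `ℓ = map π ℓ̃` — such that `H ⊄ V₊(ℓ)`: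
* `letter_clauses` — for the graded substitutions `f_O`, `f_k` of parts 1/2 (abstract, with `ker f_O = (g_O)`, `ker f_k = (ℓ)`, `g_O` linear): the FIVE
  clauses of `TCPlus.LetterDatum` (res-type-027 p626460) for the model `Λ := ker (Proj f_O)` at the initial stage, EXPLICITLY — (l-i) `Λ · 𝒪_{ℙ_k} =
  𝓘⟨closure {y | ℓ ∈ 𝔭_y}⟩` · (l-ii) principal stalks · (l-iii) `V(Λ)` regular · (l-iv) `𝟙 '' supp Λ` off the generic point of `range (ι ≫ g)` · (l-v)
  `V(Λ) → ℙ_O → Spec O` flat (in the `σ = 𝟙` shape);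
* ★ `exists_hyperplane_model` — from the COEFFICIENT data alone: a graded substitution `f_O` (section `rename (a.succAbove)`, constants fixed) with
  **`ker f_O = (ℓ̃)`** whose `ker (Proj f_O)` satisfies the five clauses — the form part 4 (`…ThroughSection`, (L2) fork (α)) and the A⁗ seed consume,
  because they must also know `Λ ≤ ker s` for the section `s`;
* ★ `TCPlus.letterDatum_hyperplane` — the packaged `TCPlus.LetterDatum O P q Y ℙ_k P (𝟙 P) g {y | ℓ ∈ 𝔭_y}`.
Ambient spelled `Fin (r + 1 + 1)` (the surviving variables are `Fin (r + 1)`, R1's typing); at the crux's `n = 3` take `r = 2` (`Fin (2+1+1) = Fin (3+1)` by `rfl`).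

References: [Hartshorne1977, II Prop. 2.5, Prop. 5.9, Ex. 3.12 (a)]; parts 1/2 and R1 `…NatLinearCentre*` (OURS, imported).
-/

set_option linter.dupNamespace false -- mandated namespace `Summit.<Summit>.<Problem>` of this single-conjunct summit
set_option linter.overlappingInstances false -- signatures carry `[IsDomain O] [IsDiscreteValuationRing O]`

noncomputable section

open CategoryTheory CategoryTheory.Limits AlgebraicGeometry TopologicalSpace
open MvPolynomial HomogeneousLocalization
open Literature.AlgebraicGeometry.Resolution
open AlgebraicGeometry.Scheme.IdealSheafData
open Summit.ResolutionOfSingularities.ResolutionOfSingularities.Cruxes.EquisingularLift.StrataSplit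

attribute [local instance] MvPolynomial.gradedAlgebra

namespace Summit.ResolutionOfSingularities.ResolutionOfSingularities.Cruxes.EquisingularLiftNat

namespace LinearLetter

/-! ## The five `LetterDatum` clauses for `Λ = ker (Proj f_O)`, abstract substitutions -/

section Clauses

variable {O k : Type} [CommRing O] [IsDomain O] [IsDiscreteValuationRing O] [Field k] (π : O →+* k)
  (hπ : Function.Surjective π) {N r : ℕ} (e : Fin (r + 1) → Fin (N + 1))
  (φ : (homogeneousSubmodule (Fin (N + 1)) O) →+*ᵍ (homogeneousSubmodule (Fin (N + 1)) k))
  (hφ : ∀ q, φ q = MvPolynomial.map π q)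
  (hφ' : HomogeneousIdeal.irrelevant (homogeneousSubmodule (Fin (N + 1)) k) ≤
    (HomogeneousIdeal.irrelevant (homogeneousSubmodule (Fin (N + 1)) O)).map φ)
  (fO : (homogeneousSubmodule (Fin (N + 1)) O) →+*ᵍ (homogeneousSubmodule (Fin (r + 1)) O))
  (hfO' : HomogeneousIdeal.irrelevant (homogeneousSubmodule (Fin (r + 1)) O) ≤
    (HomogeneousIdeal.irrelevant (homogeneousSubmodule (Fin (N + 1)) O)).map fO)
  (hfOC : ∀ b : O, fO (C b) = C b) (hfOe : ∀ j : Fin (r + 1), fO (X (e j)) = X j)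
  (fk : (homogeneousSubmodule (Fin (N + 1)) k) →+*ᵍ (homogeneousSubmodule (Fin (r + 1)) k))
  (hfk' : HomogeneousIdeal.irrelevant (homogeneousSubmodule (Fin (r + 1)) k) ≤
    (HomogeneousIdeal.irrelevant (homogeneousSubmodule (Fin (N + 1)) k)).map fk)
  (hfkC : ∀ b : k, fk (C b) = C b) (hfke : ∀ j : Fin (r + 1), fk (X (e j)) = X j)

include hπ hφ hfOC hfOe hfk' hfkC hfke in
/-- **The five `LetterDatum` clauses at the initial stage for `Λ := ker (Proj f_O)`**, explicitly and in the order of `TCPlus.LetterDatum`: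
(l-i) reduced trace `Λ · 𝒪_{ℙ_k} = 𝓘⟨closure {y | ℓ ∈ 𝔭_y}⟩` (part 2 `comap_ker_eq_vanishingIdeal`), (l-ii) principal stalks (part 2
`isPrincipal_stalkIdeal_ker`), (l-iii) `V(Λ)` regular (R1 `isRegular_kerSubscheme`), (l-iv) off the generic point of `range (ι ≫ g)` (part 1
`image_support_subset_nonGeneric_subst`, from `H ⊄ V₊(ℓ)`), (l-v) flat over `Spec O` (R1 `flat_kerSubschemeι_comp_id`). [OURS · L1 W4.5b · T23-A⁗ (F4)] -/
theorem letter_clauses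
    (hfO1 : ∀ i : Fin (N + 1), i ∉ Set.range e → (fO (X i) : MvPolynomial (Fin (r + 1)) O).IsHomogeneous 1)
    (hfkv : ∀ i : Fin (N + 1), i ∉ Set.range e → (fk (X i) : MvPolynomial (Fin (r + 1)) k) = MvPolynomial.map π (fO (X i)))
    {gO : MvPolynomial (Fin (N + 1)) O} (hgO : gO.IsHomogeneous 1) (hkerO : RingHom.ker fO = Ideal.span {gO})
    {ℓ : MvPolynomial (Fin (N + 1)) k} (hkerk : RingHom.ker fk = Ideal.span {ℓ})
    {H : Scheme.{0}} [IsIntegral H] (ι : H ⟶ Proj (homogeneousSubmodule (Fin (N + 1)) k)) [IsClosedImmersion ι]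
    (hH : ¬ Set.range ι ⊆ {y | ℓ ∈ y.asHomogeneousIdeal}) :
    (Proj.map fO hfO').ker.comap (Proj.map φ hφ') =
        vanishingIdeal (⟨closure {y : Proj (homogeneousSubmodule (Fin (N + 1)) k) | ℓ ∈ y.asHomogeneousIdeal}, isClosed_closure⟩ :
          Closeds (Proj (homogeneousSubmodule (Fin (N + 1)) k))) ∧
      (∀ z : Proj (homogeneousSubmodule (Fin (N + 1)) O), (stalkIdeal (Proj.map fO hfO').ker z).IsPrincipal) ∧
      Scheme.IsRegular (Proj.map fO hfO').ker.subscheme ∧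
      (𝟙 (Proj (homogeneousSubmodule (Fin (N + 1)) O)) : _ ⟶ _) ''
          ((Proj.map fO hfO').ker.support : Set (Proj (homogeneousSubmodule (Fin (N + 1)) O))) ⊆
        {x | ¬ IsGenericPoint x (Set.range (ι ≫ Proj.map φ hφ'))} ∧
      Flat ((Proj.map fO hfO').ker.subschemeι ≫ 𝟙 _ ≫ (Proj.toSpecZero (homogeneousSubmodule (Fin (N + 1)) O) ≫
        Spec.map (CommRingCat.ofHom (algebraMap O ((homogeneousSubmodule (Fin (N + 1)) O) 0))))) := by
  have hh : ∃ h : H, ι h ∉ ((Proj.map fk hfk').ker.support : Set (Proj (homogeneousSubmodule (Fin (N + 1)) k))) := by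
    obtain ⟨_, ⟨h, rfl⟩, hy⟩ := Set.not_subset.mp hH
    exact ⟨h, not_mem_support_of_not_mem e fk hfk' hfkC hfke hkerk hy⟩
  exact ⟨comap_ker_eq_vanishingIdeal π hπ e φ hφ hφ' fO hfO' hfOC hfOe fk hfk' hfkC hfke hfO1 hfkv hkerk,
    isPrincipal_stalkIdeal_ker e fO hfO' hfOC hfOe hgO hkerO,
    EquisingularLiftNat.LinearCentre.isRegular_kerSubscheme e fO hfO' hfOC hfOe,
    image_support_subset_nonGeneric_subst π hπ e φ hφ hφ' fO hfO' hfOC hfOe fk hfk' hfkC hfke hfO1 hfkv ι hh,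
    EquisingularLiftNat.LinearCentre.flat_kerSubschemeι_comp_id e fO hfO' hfOC hfOe⟩

end Clauses

/-! ## From the coefficient vector: the model of the hyperplane `V₊(Σ c_i x_i)` and its five clauses -/

section Model

variable {O k : Type} [CommRing O] [IsDomain O] [IsDiscreteValuationRing O] [Field k] (π : O →+* k)
  (hπ : Function.Surjective π) {r : ℕ}
  (φ : (homogeneousSubmodule (Fin (r + 1 + 1)) O) →+*ᵍ (homogeneousSubmodule (Fin (r + 1 + 1)) k))
  (hφ : ∀ q, φ q = MvPolynomial.map π q)
  (hφ' : HomogeneousIdeal.irrelevant (homogeneousSubmodule (Fin (r + 1 + 1)) k) ≤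
    (HomogeneousIdeal.irrelevant (homogeneousSubmodule (Fin (r + 1 + 1)) O)).map φ)

include hπ hφ in
/-- ★ **The model of a hyperplane letter and its five clauses, from the coefficient vector.** For `c : Fin (r+2) → O` with `c a · w = 1` and
`ℓ = map π (Σ_i C (c i) · X i)` with `H ⊄ V₊(ℓ)`: a graded substitution `f_O` (constants fixed, section `rename (a.succAbove)`, linear value on `x_a`)
with **`ker f_O = (Σ_i C (c i) · X i)`** whose `ker (Proj f_O)` has the reduced trace `𝓘⟨closure {y | ℓ ∈ 𝔭_y}⟩` along `g = Proj φ`, principal stalks,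
regular `V`, support off the generic point of `range (ι ≫ g)`, and is `O`-flat (`σ = 𝟙` shape). [OURS · L1 W4.5b · T23-A⁗ (F4) (L1)] -/
theorem exists_hyperplane_model (c : Fin (r + 1 + 1) → O) (a : Fin (r + 1 + 1)) (w : O) (hw : c a * w = 1)
    {ℓ : MvPolynomial (Fin (r + 1 + 1)) k} (hℓ : MvPolynomial.map π (∑ i, C (c i) * X i) = ℓ)
    {H : Scheme.{0}} [IsIntegral H] (ι : H ⟶ Proj (homogeneousSubmodule (Fin (r + 1 + 1)) k)) [IsClosedImmersion ι]
    (hH : ¬ Set.range ι ⊆ {y | ℓ ∈ y.asHomogeneousIdeal}) :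
    ∃ (fO : (homogeneousSubmodule (Fin (r + 1 + 1)) O) →+*ᵍ (homogeneousSubmodule (Fin (r + 1)) O))
      (hfO' : HomogeneousIdeal.irrelevant (homogeneousSubmodule (Fin (r + 1)) O) ≤
        (HomogeneousIdeal.irrelevant (homogeneousSubmodule (Fin (r + 1 + 1)) O)).map fO),
      (∀ b : O, fO (C b) = C b) ∧ (∀ j : Fin (r + 1), fO (X (Fin.succAbove a j)) = X j) ∧
      RingHom.ker fO = Ideal.span {∑ i, C (c i) * X i} ∧
      (Proj.map fO hfO').ker.comap (Proj.map φ hφ') =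
          vanishingIdeal (⟨closure {y : Proj (homogeneousSubmodule (Fin (r + 1 + 1)) k) | ℓ ∈ y.asHomogeneousIdeal},
            isClosed_closure⟩ : Closeds (Proj (homogeneousSubmodule (Fin (r + 1 + 1)) k))) ∧
      (∀ z : Proj (homogeneousSubmodule (Fin (r + 1 + 1)) O), (stalkIdeal (Proj.map fO hfO').ker z).IsPrincipal) ∧
      Scheme.IsRegular (Proj.map fO hfO').ker.subscheme ∧
      (𝟙 (Proj (homogeneousSubmodule (Fin (r + 1 + 1)) O)) : _ ⟶ _) ''
          ((Proj.map fO hfO').ker.support : Set (Proj (homogeneousSubmodule (Fin (r + 1 + 1)) O))) ⊆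
        {x | ¬ IsGenericPoint x (Set.range (ι ≫ Proj.map φ hφ'))} ∧
      Flat ((Proj.map fO hfO').ker.subschemeι ≫ 𝟙 _ ≫ (Proj.toSpecZero (homogeneousSubmodule (Fin (r + 1 + 1)) O) ≫
        Spec.map (CommRingCat.ofHom (algebraMap O ((homogeneousSubmodule (Fin (r + 1 + 1)) O) 0))))) := by
  classical
  -- the value vectors over `O` and `k`
  let vO : Fin (r + 1 + 1) → MvPolynomial (Fin (r + 1)) O :=
    Fin.insertNth a (C (-w) * ∑ j : Fin (r + 1), C (c (Fin.succAbove a j)) * X j) fun j => X j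
  have hvOe : ∀ j, vO (Fin.succAbove a j) = X j := fun j => by simp [vO]
  have hvOa : vO a = C (-w) * ∑ j : Fin (r + 1), C (c (Fin.succAbove a j)) * X j := by simp [vO]
  have hvO1 : ∀ i : Fin (r + 1 + 1), i ∉ Set.range (Fin.succAbove a) → (vO i).IsHomogeneous 1 := by
    intro i hi
    have hia : i = a := by
      have h : i ∈ (Set.range (Fin.succAbove a))ᶜ := hi
      rw [compl_range_succAbove] at h
      exact h
    rw [hia, hvOa]
    exact isHomogeneous_linVal_one a c w
  obtain ⟨fO, hfO', hfOC, hfOe, hfOv⟩ := exists_subst (R := O) (Fin.succAbove a) vO hvOe hvO1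
  let vk : Fin (r + 1 + 1) → MvPolynomial (Fin (r + 1)) k := fun i => MvPolynomial.map π (vO i)
  have hvke : ∀ j, vk (Fin.succAbove a j) = X j := fun j => by
    change MvPolynomial.map π (vO (Fin.succAbove a j)) = X j
    rw [hvOe, map_X]
  have hvk1 : ∀ i : Fin (r + 1 + 1), i ∉ Set.range (Fin.succAbove a) → (vk i).IsHomogeneous 1 :=
    fun i hi => (hvO1 i hi).map π
  obtain ⟨fk, hfk', hfkC, hfke, hfkv⟩ := exists_subst (R := k) (Fin.succAbove a) vk hvke hvk1
  -- the hypotheses of parts 1/2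
  have hfO1 : ∀ i : Fin (r + 1 + 1), i ∉ Set.range (Fin.succAbove a) →
      (fO (X i) : MvPolynomial (Fin (r + 1)) O).IsHomogeneous 1 := fun i hi => by
    rw [hfOv]; exact hvO1 i hi
  have hfkv' : ∀ i : Fin (r + 1 + 1), i ∉ Set.range (Fin.succAbove a) →
      (fk (X i) : MvPolynomial (Fin (r + 1)) k) = MvPolynomial.map π (fO (X i)) := fun i _ => by
    rw [hfkv, hfOv]
  -- the kernels: `ker f_O = (ℓ̃)`, `ker f_k = (ℓ)`
  have hvaO : fO.toRingHom (X a) = C (-w) * ∑ j : Fin (r + 1), C (c (Fin.succAbove a j)) * X j := by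
    change fO (X a) = _
    rw [hfOv, hvOa]
  have hkerO : RingHom.ker fO = Ideal.span {∑ i, C (c i) * X i} :=
    ker_eq_span_sum a fO.toRingHom c w hw hvaO (fun b => hfOC b) (fun j => hfOe j)
  have hwk : π (c a) * π w = 1 := by rw [← map_mul, hw, map_one]
  have hvak : fk.toRingHom (X a) = C (-(π w)) * ∑ j : Fin (r + 1), C (π (c (Fin.succAbove a j))) * X j := by
    change fk (X a) = _
    rw [hfkv]
    change MvPolynomial.map π (vO a) = _
    rw [hvOa, map_mul, map_C, map_neg, map_sum]
    refine congrArg _ (Finset.sum_congr rfl fun j _ => ?_)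
    rw [map_mul, map_C, map_X]
  have hkerk : RingHom.ker fk = Ideal.span {ℓ} := by
    have h := ker_eq_span_sum a fk.toRingHom (fun i => π (c i)) (π w) hwk hvak (fun b => hfkC b) (fun j => hfke j)
    rw [← hℓ, map_sum]
    simp only [map_mul, map_C, map_X]
    exact h
  refine ⟨fO, hfO', hfOC, hfOe, hkerO, ?_⟩
  exact letter_clauses π hπ (Fin.succAbove a) φ hφ hφ' fO hfO' hfOC hfOe fk hfk' hfkC hfke hfO1 hfkv'
    (isHomogeneous_sum_C_mul_X_one c) hkerO hkerk ι hH

end Model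

end LinearLetter

/-! ## The packaged `TCPlus.LetterDatum` -/

namespace Sections

variable {O k : Type} [CommRing O] [IsDomain O] [IsDiscreteValuationRing O] [Field k] (π : O →+* k)
  (hπ : Function.Surjective π) {r : ℕ}
  (φ : (homogeneousSubmodule (Fin (r + 1 + 1)) O) →+*ᵍ (homogeneousSubmodule (Fin (r + 1 + 1)) k))
  (hφ : ∀ q, φ q = MvPolynomial.map π q)
  (hφ' : HomogeneousIdeal.irrelevant (homogeneousSubmodule (Fin (r + 1 + 1)) k) ≤
    (HomogeneousIdeal.irrelevant (homogeneousSubmodule (Fin (r + 1 + 1)) O)).map φ)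

include hπ hφ in
/-- ★ **`TCPlus.letterDatum_hyperplane` — a HYPERPLANE LETTER HAS A MODEL AT THE INITIAL STAGE.** In the EL♮ ambient `P = ℙ^{r+1}_O → Spec O`
(`O` a DVR, `π : O ↠ k`, `g = Proj (map π) : ℙ_k → ℙ_O`, `Y = (ι ≫ g)(H)` for an integral closed `ι : H ↪ ℙ_k`), every linear form `ℓ̃ = Σ_i c_i x_i`
over `O` with a unit coefficient whose reduction `ℓ = map π ℓ̃` does not vanish on all of `H` gives
`TCPlus.LetterDatum O P q Y ℙ_k P (𝟙 P) g {y | ℓ ∈ 𝔭_y}` (res-type-027 p626460: a model `𝓛` with reduced trace `𝓘⟨V₊(ℓ)⟩`, principal stalks, `V(𝓛)`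
regular, off the generic point of `Y`, `O`-flat) — with `𝓛 = ker (Proj f_O) = V₊(ℓ̃)` of `LinearLetter.exists_hyperplane_model`. res-L1-w45b-stub-4 ENGINE WORD
v2 FINAL 81913c484db62a21 §1. [OURS · L1 W4.5b · T23-A⁗ (F4) (L1)/(L3)] -/
theorem TCPlus.letterDatum_hyperplane (c : Fin (r + 1 + 1) → O) (a : Fin (r + 1 + 1)) (w : O) (hw : c a * w = 1)
    {ℓ : MvPolynomial (Fin (r + 1 + 1)) k} (hℓ : MvPolynomial.map π (∑ i, C (c i) * X i) = ℓ)
    {H : Scheme.{0}} [IsIntegral H] (ι : H ⟶ Proj (homogeneousSubmodule (Fin (r + 1 + 1)) k)) [IsClosedImmersion ι]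
    (hH : ¬ Set.range ι ⊆ {y | ℓ ∈ y.asHomogeneousIdeal})
    {Y : Set (Proj (homogeneousSubmodule (Fin (r + 1 + 1)) O))} (hY : Y = Set.range (ι ≫ Proj.map φ hφ')) :
    TCPlus.LetterDatum O (Proj (homogeneousSubmodule (Fin (r + 1 + 1)) O))
      (Proj.toSpecZero (homogeneousSubmodule (Fin (r + 1 + 1)) O) ≫
        Spec.map (CommRingCat.ofHom (algebraMap O ((homogeneousSubmodule (Fin (r + 1 + 1)) O) 0))))
      Y (Proj (homogeneousSubmodule (Fin (r + 1 + 1)) k)) (Proj (homogeneousSubmodule (Fin (r + 1 + 1)) O)) (𝟙 _)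
      (Proj.map φ hφ') {y | ℓ ∈ y.asHomogeneousIdeal} := by
  subst hY
  obtain ⟨fO, hfO', -, -, -, h1, h2, h3, h4, h5⟩ :=
    LinearLetter.exists_hyperplane_model π hπ φ hφ hφ' c a w hw hℓ ι hH
  exact ⟨(Proj.map fO hfO').ker, h1, h2, h3, h4, h5⟩

end Sections

end Summit.ResolutionOfSingularities.ResolutionOfSingularities.Cruxes.EquisingularLiftNat

end
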